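import Summits.BirchSwinnertonDyer.BirchSwinnertonDyer.Theorems.KimAtThreeDeepUpperBadPlaceDescent
import Summits.BirchSwinnertonDyer.Rank1Residual.GaloisImage.KolyvaginDerivativeUnramifiedLift
import Summits.BirchSwinnertonDyer.Rank1Residual.GaloisImage.PropagatedConditionStableRangeThree
import Summits.BirchSwinnertonDyer.Rank1Residual.GaloisImage.SelmerClassInertiaConverse
import Summits.BirchSwinnertonDyer.Rank1Residual.GaloisImage.ContinuousH1CoefficientTransport
import Literature.NumberTheory.EllipticCurves.GaloisActionProofs
import HarnessLib

/-!
# D7-u in `ℤ`-currency: at a finite place `w ∉ r ∪ {3}` (bad `w` with `E(ℚ_w)[3] ≠ 0` INCLUDED)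
# Kolyvagin's derivative class of an Euler system of `T₃E` unramified above `w` satisfies
# Mazur–Rubin's canonical condition `loc_w (Φ κ_r) ∈ 𝓕_can,w = propagatedSelmerStructure W 3 k (inr w)`
# — NO condition on the Kolyvagin primes (cell `bsd-addord`, seat w2-c3 gen 5; route W2
# `KimAtThreeKolyvagin`, crux 19076 `DeepUpperAtThree`, §U child 19560, residual (C3))

HONEST FRAMING: TOOL theorem (no definition, no named fact, no `sorry`); closes nothing by itself;
nothing is booked; BSD is not proved by any of this.  It is n1011-p15's T-DER-D4BN F1
`Derivative.Rat.localization_mem_propagatedSelmerStructure_of_res_eq_deriv_of_not_dvd_orderOf`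
(`KolyvaginSystemOfEulerSystemBadPlaces`) with the prime-thinning hypothesis
`hord : ¬ p ∣ ord(w mod n(r))` REPLACED by the Euler-system axioms + the (C2)-type unramifiedness
`hur` of the classes `c_{⊥,s}` above `w` (Kato (8.1.3): `z_m ∈ H¹(ℤ[ζ_m, 1/p], T)`; the tree's
`ZetaBody` carries it), at `p = 3` (the level-`k` stable range is typed at `3`:
`PropagatedConditionStableRangeThree`).

## What and how (the consumer note `ENDB-U-CONSUMER-NOTE.md` of n1011-p15 g27, executed)

`localization_mem_propagatedSelmerStructure_three_of_unramified`: data of THEOREM B-u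
(`KimAtThreeDeepUpperBadPlaceDescent.exists_rep_apply_eq_red_invariant_of_unramified`: an Euler
system `c` of `T₃E` over levels `L`, THEOREM A's bottom-layer data `σ N Fr`, `red : T₃E ⟶ T′` with
`T′` killed by `N_ℓ`, `P_ℓ(1)` and `(T′)^{U_r} = 0`, `κ` with `res_{U_r} κ = D_r (red_* c_{⊥,r})`,
`w` unramified in `U_r`, `hur`) plus GZ-4's pin of the coefficients (`e : T′ → E[3^k·3]` additive
continuous equivariant with `π_{k+1} = e ∘ red`, `Φ` computed on cocycles by `e`).  CONCLUSION:
`loc_w (Φ κ) ∈ propagatedSelmerStructure W 3 k (Sum.inr w)`.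
Proof: (1) THEOREM B-u: `κ = [k]`, `k′ := k − ∂v` vanishes on `I_{𝔓₀}` and is `red(T^{I_{𝔓₀}})`-
valued on `D_w = res(Γ_{ℚ_w})`; (2) finite detour: with `m = k + N₀(w)` (the `3`-power torsion
stabilisation level of `E(ℚ_w)`, `exists_torsion_stable`) and `r_m : E[3^m·3] → E[3^k·3]`
(`exists_torsionReduction_three`), `e(red t) = π_{k+1}(t) = r_m(π_{m+1}(t))` (`pow_smul_proj_add`),
so the local cocycle `e ∘ k′ ∘ res_w` vanishes on `I_{ℚ_w}` (`inertia_adicCompletionPrime_eq_map_absInertia`)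
and takes values `r_m(x)` with `x ∈ E[3^m·3]^{I_{ℚ_w}}`; (3) U4
(`Derivative.exists_map_eq_oneCocycleClass_of_apply_eq_hom_invariant`, finite discrete
coefficients): it is `(r_m)_* z` for some `z ∈ H¹(ℚ_w, E[3^m·3])`; (4) the stable range
(`localMap_red_mem_propagatedSelmerStructure_three`): `(r_m)_* z ∈ 𝓕_can(E[3^k·3])_w`.
This is [MR04] Remark A.5 (`κ_r ∈ H¹_{𝓕_u} ⊆ H¹_{𝓕can}`) at `w`, in the tree's currency.

References: B. Mazur, K. Rubin, *Kolyvagin systems*, Mem. AMS 799 (2004), Def. 3.2.1, Thm. 3.2.4,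
App. A Prop. A.2 + Remark A.5; K. Rubin, *Euler Systems* (2000), Lemma 4.4.2, Thm. 4.5.1; K. Kato,
Astérisque 295 (2004), (8.1.3); K. Büyükboduk, JNT 129 (2009) §3.
-/

noncomputable section

-- the cell's Theorems namespace `Summit.BirchSwinnertonDyer.BirchSwinnertonDyer.…` repeats the summit name by design (D-0017)
set_option linter.dupNamespace false

open CategoryTheory Function Finset Polynomial Field IsDedekindDomain NumberField
open scoped NumberField Classical Pointwise
open Literature.NumberTheory.GaloisRepresentations Literature.NumberTheory.EllipticCurves
open Literature.NumberTheory.GaloisRepresentations.IsNonarchimedeanLocalField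
open WeierstrassCurve
open Summit.BirchSwinnertonDyer.Rank1Residual.GaloisImage
open Summit.BirchSwinnertonDyer.Rank1Residual.GaloisImage.Derivative
open Summit.BirchSwinnertonDyer.Rank1Residual.GaloisImage.CoeffTransport
open Summit.BirchSwinnertonDyer.BirchSwinnertonDyer.Theorems.KimAtThreeDeepUpperBadPlaceDescent

universe w

namespace Summit.BirchSwinnertonDyer.BirchSwinnertonDyer.Theorems.KimAtThreeDeepUpperBadPlaceCondition

variable (W : WeierstrassCurve ℚ) [W.IsElliptic] [Fact (Nat.Prime 3)]
variable [Module.Free ℤ_[3] (W.tateModule 3)] [Module.Finite ℤ_[3] (W.tateModule 3)]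
  [ContinuousSMul ℤ_[3] (W.tateModule 3)]

/-- Local notation: `T∞ = T₃ E` as a continuous `Γ_ℚ`-representation. -/
local notation3 "T∞" => WeierstrassCurve.tateGaloisRep W 3 (W.continuous_galoisRepTate_holds 3)

/-- **D7-u in `ℤ`-currency** (module docstring): for an Euler system `c` of `T₃E` over levels `L`,
THEOREM A's bottom-layer data, a `ℤ₃`-linear coefficient representation `T′` pinned to `E[3^k·3]`
by `(red, e, hcomp)` and a transport `Φ` computed on cocycles by `e`, Kolyvagin's class `κ`
(`res_{U_r} κ = D_r (red_* c_{⊥,r})`), and a finite place `w` unramified in `U_r` above which every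
`c_{⊥,s}`, `s ⊆ r`, is unramified: `loc_w (Φ κ) ∈ propagatedSelmerStructure W 3 k (Sum.inr w)`.
No hypothesis on the primes of `r` besides `w ∉ r` (through `hwU`), none on the reduction of `E`
at `w`, none on `E(ℚ_w)[3]`. [cite: MazurRubin2004, Def. 3.2.1, Thm. 3.2.4 and App. A Remark A.5 (p. 81)]
[cite: Rubin2000, Lemma 4.4.2 and Thm. 4.5.1] -/
theorem localization_mem_propagatedSelmerStructure_three_of_unramified
    {ι : Type w} [Preorder ι] [OrderBot ι] {L : EulerSystemLevels ℚ ι}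
    {c : ∀ (i : ι) (r : L.Ideals), H1 T∞ (L.level i r.1)} (hc : IsEulerSystem L T∞ 3 c)
    {M' : Type} [AddCommGroup M'] [Module ℤ_[3] M'] [TopologicalSpace M'] [IsTopologicalAddGroup M']
    [ContinuousSMul ℤ_[3] M'] {T' : GaloisRep ℚ ℤ_[3] M'}
    (red : (T∞).toTopRep ⟶ T'.toTopRep) (k : ℕ)
    (e : M' →+ geomTorsion W (((3 : ℕ) : ℤ) ^ k * ((3 : ℕ) : ℤ))) (hec : Continuous e)
    (he : ∀ (g : absoluteGaloisGroup ℚ) (x : M'),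
      e (T' g x) = W.torsionGaloisModule (((3 : ℕ) : ℤ) ^ k * ((3 : ℕ) : ℤ)) g (e x))
    (hcomp : ∀ a : W.tateModule 3, tateToTorsion W 3 k a = e (red.hom a))
    (Φ : continuousCohomology 1 T'.toTopRep →+
      galoisCohomology (W.torsionGaloisModule (((3 : ℕ) : ℤ) ^ k * ((3 : ℕ) : ℤ))) 1)
    (hΦ : ∀ (φ : contOneCocycles T'.toTopRep)
      (ψ : contOneCocycles (W.torsionGaloisModule (((3 : ℕ) : ℤ) ^ k * ((3 : ℕ) : ℤ))).toTopRep),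
      (∀ g, ψ.1 g = e (φ.1 g)) → Φ (oneCocycleClass _ φ) = oneCocycleClass _ ψ)
    (r : L.Ideals)
    (σ : HeightOneSpectrum (𝓞 ℚ) → absoluteGaloisGroup ℚ) (N : HeightOneSpectrum (𝓞 ℚ) → ℕ)
    (Fr : HeightOneSpectrum (𝓞 ℚ) → absoluteGaloisGroup ℚ)
    (hσ : ∀ ℓ ∈ r.1, ∀ q ∈ r.1, q ≠ ℓ → σ ℓ ∈ L.tameLevel q)
    (hcov : ∀ ℓ ∈ r.1, ∀ g : absoluteGaloisGroup ℚ, ∃ j < N ℓ, (σ ℓ ^ j)⁻¹ * g ∈ L.tameLevel ℓ)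
    (hinj : ∀ ℓ ∈ r.1, ∀ j₁ < N ℓ, ∀ j₂ < N ℓ, (σ ℓ ^ j₁)⁻¹ * σ ℓ ^ j₂ ∈ L.tameLevel ℓ → j₁ = j₂)
    (hFr : ∀ ℓ ∈ r.1, IsArithFrobAtPlace ℚ ℓ (Fr ℓ))
    (hram : ∀ ℓ ∈ r.1, ∀ s ⊆ r.1, ℓ ∉ s → ¬ SubgroupIsUnramifiedAt ℚ (L.level ⊥ (insert ℓ s)) ℓ)
    (hM₁ : ∀ ℓ ∈ r.1, ∀ v : M', (N ℓ : ℤ_[3]) • v = 0)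
    (hM₂ : ∀ ℓ ∈ r.1, ∀ v : M',
      (rubinEulerFactor (T∞).toRepresentation (cyclotomicCharacterToUnits ℚ 3 ℤ_[3]) (Fr ℓ)).eval 1 •
        v = 0)
    (comm)
    (h0 : ∀ v : T'.toTopRep, (∀ u : L.level ⊥ r.1, T'.toTopRep.ρ (u : absoluteGaloisGroup ℚ) v = v) →
      v = 0)
    (κ : continuousCohomology 1 T'.toTopRep)
    (hκ : resSubgroup T'.toTopRep (L.level ⊥ r.1) 1 κ =
        (r.1.noncommProd (fun ℓ => ∑ j ∈ range (N ℓ), (j : Module.End ℤ_[3] (continuousCohomology 1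
          (subgroupRep T'.toTopRep (L.level ⊥ r.1)))) *
          (conjMap T'.toTopRep (L.level ⊥ r.1) (σ ℓ) 1).hom.toLinearMap ^ j) comm)
        (ContinuousCohomology.map (ContinuousMonoidHom.id _) (X := subgroupRep (T∞).toTopRep (L.level ⊥ r.1))
          (Y := subgroupRep T'.toTopRep (L.level ⊥ r.1))
          ((TopRep.resFunctor (L.level ⊥ r.1).subtype).map red) 1 (c ⊥ r)))
    (w : HeightOneSpectrum (𝓞 ℚ)) (hwU : SubgroupIsUnramifiedAt ℚ (L.level ⊥ r.1) w)
    (hur : ∀ (s : Finset (HeightOneSpectrum (𝓞 ℚ))) (hs : s ⊆ r.1)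
      (𝔓 : Ideal (absIntegers (𝓞 ℚ) ℚ)) (h𝔓 : 𝔓 ∈ w.primesAbove),
      resLe (T∞).toTopRep (hwU 𝔓 h𝔓) 1
        (resLe (T∞).toTopRep (level_antitone L ⊥ hs) 1 (c ⊥ ⟨s, fun q hq => r.2 q (hs hq)⟩)) = 0) :
    galoisCohomology.localization (W.torsionGaloisModule (((3 : ℕ) : ℤ) ^ k * ((3 : ℕ) : ℤ)))
        (Sum.inr w) 1 (Φ κ) ∈ propagatedSelmerStructure W 3 k (Sum.inr w) := by
  classical
  set F := w.adicCompletion ℚ with hFdef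
  set θ : absoluteGaloisGroup F →ₜ* absoluteGaloisGroup ℚ := absGaloisRestrict ℚ F with hθdef
  set 𝔓₀ : Ideal (absIntegers (𝓞 ℚ) ℚ) := adicCompletionPrime ℚ w with h𝔓₀def
  -- (1) THEOREM B-u
  obtain ⟨kk, v, hκk, hI, hD⟩ := exists_rep_apply_eq_red_invariant_of_unramified hc red r σ N Fr hσ
    hcov hinj hFr hram hM₁ hM₂ comm h0 κ hκ w hwU hur
  -- the adjusted cocycle `k′ = k − ∂v`
  have hT'c : ∀ x : T'.toTopRep, Continuous fun g : absoluteGaloisGroup ℚ => T'.toTopRep.ρ g x :=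
    fun x => T'.continuous_apply_left x
  let δ : contOneCocycles T'.toTopRep :=
    ⟨⟨fun g => T'.toTopRep.ρ g v - v, (hT'c v).sub continuous_const⟩, fun g h => by
        change T'.toTopRep.ρ (g * h) v - v = (T'.toTopRep.ρ g v - v) + T'.toTopRep.ρ g (T'.toTopRep.ρ h v - v)
        rw [map_sub, ρ_mul_apply]; abel⟩
  have hδ : oneCocycleClass _ δ = 0 := (oneCocycleClass_eq_zero_iff T'.toTopRep δ).mpr ⟨v, fun _ => rfl⟩
  set k' : contOneCocycles T'.toTopRep := kk - δ with hk'def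
  have hk'cl : oneCocycleClass _ k' = κ := by
    rw [hk'def, oneCocycleClass_sub, hδ, sub_zero, hκk]
  have hk'app : ∀ g, k'.1 g = kk.1 g - (T'.toTopRep.ρ g v - v) := fun g => rfl
  -- `Φ κ = [e ∘ k′]`
  let ψ : contOneCocycles (W.torsionGaloisModule (((3 : ℕ) : ℤ) ^ k * ((3 : ℕ) : ℤ))).toTopRep :=
    ⟨_, comp_mem_contOneCocycles T'.toTopRep
      (W.torsionGaloisModule (((3 : ℕ) : ℤ) ^ k * ((3 : ℕ) : ℤ))).toTopRep e hec (fun g x => he g x) k'⟩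
  have hψ : ∀ g, ψ.1 g = e (k'.1 g) := fun _ => rfl
  have hΦκ : Φ κ = oneCocycleClass _ ψ := by rw [← hk'cl]; exact hΦ k' ψ hψ
  -- (2) the finite detour: stable range level `m = k + N₀` and the reduction `r_m`
  obtain ⟨N₀, hstab⟩ := exists_torsion_stable W 3 w
  obtain ⟨rm, hrm⟩ := exists_torsionReduction_three W k (k + N₀)
  -- the local modules
  let ρm := GaloisRep.restrictField F (W.torsionGaloisModule (((3 : ℕ) : ℤ) ^ (k + N₀) * ((3 : ℕ) : ℤ)))
  let ρk := GaloisRep.restrictField F (W.torsionGaloisModule (((3 : ℕ) : ℤ) ^ k * ((3 : ℕ) : ℤ)))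
  let π : DiscreteGaloisModule.toTopRep ρm ⟶ DiscreteGaloisModule.toTopRep ρk :=
    TopRep.ofHom ⟨(rm.restrictField F).toContinuousLinearMap, (rm.restrictField F).isIntertwining'⟩
  -- the local cocycle `ψ_w = ψ ∘ res_w`
  let ψw : contOneCocycles (DiscreteGaloisModule.toTopRep ρk) :=
    contOneCocycles.pullback θ (X := (W.torsionGaloisModule (((3 : ℕ) : ℤ) ^ k * ((3 : ℕ) : ℤ))).toTopRep)
      (Y := DiscreteGaloisModule.toTopRep ρk) (TopRep.ofHom ⟨ContinuousLinearMap.id ℤ _, fun _ => rfl⟩) ψ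
  have hψw : ∀ g, ψw.1 g = e (k'.1 (θ g)) := fun g => rfl
  have hloc : galoisCohomology.localization (W.torsionGaloisModule (((3 : ℕ) : ℤ) ^ k * ((3 : ℕ) : ℤ)))
      (Sum.inr w) 1 (Φ κ) = oneCocycleClass _ ψw := by
    rw [hΦκ]
    exact galoisCohomology.res_one_oneCocycleClass F ψ
  -- inertia dictionary: `res(I_{ℚ_w}) ⊆ I_{𝔓₀}`
  have hθI : ∀ u ∈ galUnr F, θ u ∈ 𝔓₀.inertia (absoluteGaloisGroup ℚ) := by
    intro u hu
    rw [h𝔓₀def, inertia_adicCompletionPrime_eq_map_absInertia]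
    rw [galUnr_eq_absInertia] at hu
    exact Subgroup.mem_map_of_mem _ hu
  -- (3) U4's hypotheses
  have h3m : (((3 : ℕ) : ℤ) ^ (k + N₀) * ((3 : ℕ) : ℤ)) ≠ 0 := by positivity
  haveI : Finite (geomTorsion W (((3 : ℕ) : ℤ) ^ (k + N₀) * ((3 : ℕ) : ℤ))) :=
    finite_torsionPoints_holds W (AlgebraicClosure ℚ) h3m
  have hkN : ∀ u ∈ galUnr F, ψw.1 u = 0 := by
    intro u hu
    rw [hψw, hk'app, hI (θ u) (hθI u hu), map_zero]
  have hkv : ∀ g : absoluteGaloisGroup F,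
      ∃ t : geomTorsion W (((3 : ℕ) : ℤ) ^ (k + N₀) * ((3 : ℕ) : ℤ)),
        (∀ u ∈ galUnr F, ρm u t = t) ∧ ψw.1 g = π.hom t := by
    intro g
    obtain ⟨t, htI, hkt⟩ := hD (θ g) ⟨g, rfl⟩
    refine ⟨tateToTorsion W 3 (k + N₀) t, fun u hu => ?_, ?_⟩
    · -- invariance under the local inertia: `π_{m+1}` is equivariant and `t ∈ T^{I_{𝔓₀}}`
      have h1 : ρm u (tateToTorsion W 3 (k + N₀) t) =
          tateToTorsion W 3 (k + N₀) ((T∞).toTopRep.ρ (θ u) t) := Subtype.ext rfl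
      rw [h1, htI (θ u) (hθI u hu)]
    · -- value: `e (red t) = π_{k+1} t = r_m (π_{m+1} t)`
      rw [hψw, hk'app, hkt, ← hcomp]
      change tateToTorsion W 3 k t = rm (tateToTorsion W 3 (k + N₀) t)
      apply Subtype.ext
      rw [hrm, coe_tateToTorsion_apply, coe_tateToTorsion_apply, Nat.add_sub_cancel_left,
        ← Nat.cast_pow, natCast_zsmul,
        show k + N₀ + 1 = (k + 1) + N₀ by omega, TateModule.pow_smul_proj_add]
  obtain ⟨z, hz⟩ := exists_map_eq_oneCocycleClass_of_apply_eq_hom_invariant ρm ρk π ψw hkN hkv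
  -- `localMap r_m (inr w) z = [ψ_w]`
  have hlm : DiscreteGaloisModule.localMap rm (Sum.inr w) z = oneCocycleClass _ ψw := by
    obtain ⟨ζ, rfl⟩ := oneCocycleClass_surjective _ z
    rw [← hz]
    change galoisCohomology.map (rm.restrictField F) 1 (oneCocycleClass (DiscreteGaloisModule.toTopRep ρm) ζ) = _
    rw [galoisCohomology.map_one_oneCocycleClass, cohomologyMap_oneCocycleClass]
    exact congrArg _ (Subtype.ext (ContinuousMap.ext fun _ => rfl))
  -- (4) the stable range
  rw [hloc, ← hlm]
  exact localMap_red_mem_propagatedSelmerStructure_three W w hstab k (k + N₀) le_rfl rm hrm z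

end Summit.BirchSwinnertonDyer.BirchSwinnertonDyer.Theorems.KimAtThreeDeepUpperBadPlaceCondition

end
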